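import Literature.AlgebraicGeometry.Resolution.PointCentrePermissible
import Literature.AlgebraicGeometry.Resolution.ComponentGluing
import Literature.AlgebraicGeometry.Resolution.BlowupsExistence
import Literature.AlgebraicGeometry.Resolution.CofinalityFromPrincipalization
import Literature.AlgebraicGeometry.Resolution.ArithmeticalThreefoldsBlowupFormDimThree
import HarnessLib

/-!
# Principalization by point blow-ups: one step at a bad closed point, and «no infinite run of bad points ⇒
# principalization» (the shape of Zariski's finiteness theorem, Lipman 1969 (26.1)/(26.2))

Topic: `Literature/AlgebraicGeometry/Resolution`. PROVED, fact-free, definition-free (hand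
leafhand-res-homologicalconduct-16 g2 of the cell decomp-res; AI-written bookkeeping over tree theorems,
weaker than expert review).

Lipman 1969, proof of Theorem (26.1) (p. 274): «Let `g₁ : Z₁ → X` be obtained by blowing up a point of
indeterminacy … If … no points of indeterminacy, we are done. Otherwise, repeat the process … If the process ever
stops, the theorem is proved. If not, there is obtained an infinite sequence … In any case, we are led to the
following statement [Theorem (26.2)]: … Then the sequence (S) is finite.»  This file is exactly that reduction for
the PRINCIPALIZATION of an ideal sheaf `J ≠ 0` on a regular integral Noetherian scheme `X` (the «points of
indeterminacy» being the closed points of the non-locally-principal locus of the transform of `J`), in the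
vocabulary of Cossart–Piltant sequences `IsRegularCentreBlowupSeq` (`Principalization.lean`):

* `IsRegularCentreBlowupSeq.exists_cons_closedPoint` — ONE STEP: a Cossart–Piltant sequence `σ : X' → X` for `J`
  and a CLOSED point `x ∈ X'` at which `J·𝒪_{X'}` is not locally principal extend to `τ ≫ σ`, `τ` the blowing up
  of `X'` at `x` (the reduced point is an integral regular centre: tree `isRegular_subscheme_vanishingIdeal_singleton`,
  `isIntegral_subscheme_vanishingIdeal`; existence `exists_isBlowup`);
* `exists_isRegularCentreBlowupSeq_isLocallyPrincipal_of_noInfiniteRun` — **if there is NO infinite run**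
  `X = X₀ ← X₁ ← X₂ ← ⋯`, each `X_{n+1} → X_n` the blowing up of a closed point `x_n` at which `J·𝒪_{X_n}` is not
  locally principal, **then some Cossart–Piltant sequence `σ : X' → X` principalizes `J`** (`J·𝒪_{X'}` locally
  principal) — by dependent choice: otherwise every sequence has a bad closed point (the non-principal locus is
  closed and non-empty in the quasi-compact `X'`, `IsClosed.exists_closed_singleton`) and the one-step lemma
  builds an infinite run;
* `exists_isResolution_isEffectiveCartier_of_noInfiniteRun` — hence a resolution `j : Z → X` with `J·𝒪_Z` an
  effective Cartier divisor (`IsRegularCentreBlowupSeq.isResolution`, `IsLocallyPrincipal.isEffectiveCartier_of_ne_bot`):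
  the hypothesis shape (PRINC) of `Lipman1969_1_2_B_of_principalization[_finite]`.

What is NOT here: the finiteness itself (Theorem (26.2): an infinite run is dominated by one of finitely many
exceptional prime divisors, along which finitely generated ideals become principal — tree
`QuadraticSequencePrincipalGenerator.exists_principal_generator_of_quadraticSequence`).  No summit statement is proved.

## References
* J. Lipman, Publ. Math. IHÉS 36 (1969), Theorems (26.1), (26.2) and the proof of (26.1) (p. 274). [Lipman1969]
* V. Cossart, O. Piltant, J. Algebra 320 (2008), proof of Prop. 4.4 (closed points are permissible centres).
  [CossartPiltant2008]
-/

noncomputable section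

open CategoryTheory CategoryTheory.Limits AlgebraicGeometry TopologicalSpace

universe u

namespace Literature.AlgebraicGeometry.Resolution

open Scheme.IdealSheafData

/-! ## One step: blow up a bad closed point -/

/-- **One step of Zariski's process.** A Cossart–Piltant sequence `σ : X' → X` for `J` and a closed point `x ∈ X'`
at which `J·𝒪_{X'} = J.comap σ` is not locally principal extend, by the blowing up `τ : X'' → X'` of `X'` at `x`
(reduced point, an integral regular centre inside the non-principal locus), to the Cossart–Piltant sequence
`τ ≫ σ`. [cite: Lipman1969, Theorem (26.1), proof (p. 274)] [cite: CossartPiltant2008, proof of Prop. 4.4] -/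
theorem IsRegularCentreBlowupSeq.exists_cons_closedPoint {X' X : Scheme.{u}} {σ : X' ⟶ X}
    {J : X.IdealSheafData} (hσ : IsRegularCentreBlowupSeq σ J) [IsLocallyNoetherian X'] {x : X'}
    (hx : IsClosed ({x} : Set X')) (hbad : ¬ IsLocallyPrincipalAt (J.comap σ) x) :
    ∃ (X'' : Scheme.{u}) (τ : X'' ⟶ X'), IsBlowup τ (vanishingIdeal (⟨{x}, hx⟩ : Closeds X')) ∧
      IsRegularCentreBlowupSeq (τ ≫ σ) J := by
  obtain ⟨X'', τ, hτ⟩ := exists_isBlowup X' (vanishingIdeal (⟨{x}, hx⟩ : Closeds X'))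
  refine ⟨X'', τ, hτ, hσ.cons' (isIntegral_subscheme_vanishingIdeal _ isIrreducible_singleton)
    (isRegular_subscheme_vanishingIdeal_singleton hx) (fun y hy => ?_) hτ⟩
  have hy' : y = x := hy
  subst hy'
  rw [mem_nonPrincipalLocus_iff]
  exact hbad

/-! ## No infinite run of bad closed points ⇒ principalization -/

section NoInfiniteRun

variable {X : Scheme.{u}} [IsIntegral X] [IsNoetherian X] (hX : Scheme.IsRegular X)
  {J : X.IdealSheafData} (hJ : J ≠ ⊥)

include hX hJ

/-- **Lipman's reduction of Theorem (26.1) to Theorem (26.2), for principalization.**  Let `X` be a regular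
integral Noetherian scheme and `J ≠ 0` an ideal sheaf.  If there is no infinite run
`(X_n, σ_n : X_n → X, τ_n : X_{n+1} → X_n, x_n)` with every `σ_n` a Cossart–Piltant sequence for `J`,
`τ_n ≫ σ_n = σ_{n+1}`, `τ_n` the blowing up of the closed point `x_n`, and `J·𝒪_{X_n}` not locally principal at
`x_n`, then some Cossart–Piltant sequence `σ : X' → X` has `J·𝒪_{X'}` locally principal.
[cite: Lipman1969, Theorems (26.1), (26.2), proof of (26.1) (p. 274)] -/
theorem exists_isRegularCentreBlowupSeq_isLocallyPrincipal_of_noInfiniteRun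
    (hrun : ∀ (Y : ℕ → Scheme.{u}) (σ : ∀ n, Y n ⟶ X) (τ : ∀ n, Y (n + 1) ⟶ Y n) (x : ∀ n, Y n)
      (hx : ∀ n, IsClosed ({x n} : Set (Y n))),
      (∀ n, IsRegularCentreBlowupSeq (σ n) J) → (∀ n, τ n ≫ σ n = σ (n + 1)) →
      (∀ n, IsBlowup (τ n) (vanishingIdeal (⟨{x n}, hx n⟩ : Closeds (Y n)))) →
      (∀ n, ¬ IsLocallyPrincipalAt (J.comap (σ n)) (x n)) → False) :
    ∃ (X' : Scheme.{u}) (σ : X' ⟶ X), IsRegularCentreBlowupSeq σ J ∧ IsLocallyPrincipal (J.comap σ) := by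
  classical
  by_contra hcon
  push Not at hcon
  -- states: Cossart–Piltant sequences for `J`
  let T : Type (u + 1) := Σ (Y : Scheme.{u}), { σ : Y ⟶ X // IsRegularCentreBlowupSeq σ J }
  -- every state has a bad closed point and hence a successor
  have hstep : ∀ s : T, ∃ (s' : T) (τ : s'.1 ⟶ s.1) (x : s.1) (hx : IsClosed ({x} : Set s.1)),
      τ ≫ s.2.1 = s'.2.1 ∧ IsBlowup τ (vanishingIdeal (⟨{x}, hx⟩ : Closeds s.1)) ∧
      ¬ IsLocallyPrincipalAt (J.comap s.2.1) x := by
    rintro ⟨Y, σ, hσ⟩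
    have hres : IsResolution σ := hσ.isResolution hJ hX
    haveI : IsProper σ := hres.isProper
    haveI : IsLocallyNoetherian Y := LocallyOfFiniteType.isLocallyNoetherian σ
    haveI : CompactSpace Y := QuasiCompact.compactSpace_of_compactSpace σ
    -- a bad closed point
    have hne : ((nonPrincipalLocus (J.comap σ) : Closeds Y) : Set Y).Nonempty := by
      by_contra h
      rw [Set.not_nonempty_iff_eq_empty] at h
      apply hcon Y σ hσ
      intro y
      by_contra hy
      have : y ∈ ((nonPrincipalLocus (J.comap σ) : Closeds Y) : Set Y) := by
        rw [SetLike.mem_coe, mem_nonPrincipalLocus_iff]; exact hy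
      rw [h] at this
      exact this
    obtain ⟨x, hxmem, hxcl⟩ := (nonPrincipalLocus (J.comap σ)).isClosed.exists_closed_singleton hne
    have hbad : ¬ IsLocallyPrincipalAt (J.comap σ) x := by
      rw [SetLike.mem_coe, mem_nonPrincipalLocus_iff] at hxmem; exact hxmem
    obtain ⟨Y', τ, hτ, hσ'⟩ := hσ.exists_cons_closedPoint hxcl hbad
    exact ⟨⟨Y', τ ≫ σ, hσ'⟩, τ, x, hxcl, rfl, hτ, hbad⟩
  choose next τ x hx hcomp hbl hbad using hstep
  -- the infinite run from the empty sequence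
  let s₀ : T := ⟨X, 𝟙 X, IsRegularCentreBlowupSeq.nil J⟩
  let seq : ℕ → T := fun n => Nat.rec s₀ (fun _ s => next s) n
  have hseq : ∀ n, seq (n + 1) = next (seq n) := fun n => rfl
  exact hrun (fun n => (seq n).1) (fun n => (seq n).2.1) (fun n => τ (seq n)) (fun n => x (seq n))
    (fun n => hx (seq n)) (fun n => (seq n).2.2) (fun n => hcomp (seq n)) (fun n => hbl (seq n))
    (fun n => hbad (seq n))

/-- **Hence a principalizing resolution.**  Under the same «no infinite run» hypothesis there is a resolution
`j : Z → X` (proper, birational, `Z` regular — `IsRegularCentreBlowupSeq.isResolution`) with `J·𝒪_Z` an effective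
Cartier divisor (`IsLocallyPrincipal.isEffectiveCartier_of_ne_bot`): the hypothesis shape (PRINC) of
`Lipman1969_1_2_B_of_principalization` / `…_finite`. [cite: Lipman1969, Theorems (26.1), (26.2) (p. 274)] -/
theorem exists_isResolution_isEffectiveCartier_of_noInfiniteRun
    (hrun : ∀ (Y : ℕ → Scheme.{u}) (σ : ∀ n, Y n ⟶ X) (τ : ∀ n, Y (n + 1) ⟶ Y n) (x : ∀ n, Y n)
      (hx : ∀ n, IsClosed ({x n} : Set (Y n))),
      (∀ n, IsRegularCentreBlowupSeq (σ n) J) → (∀ n, τ n ≫ σ n = σ (n + 1)) →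
      (∀ n, IsBlowup (τ n) (vanishingIdeal (⟨{x n}, hx n⟩ : Closeds (Y n)))) →
      (∀ n, ¬ IsLocallyPrincipalAt (J.comap (σ n)) (x n)) → False) :
    ∃ (Z : Scheme.{u}) (j : Z ⟶ X), IsResolution j ∧ IsEffectiveCartier (J.comap j) := by
  obtain ⟨Z, j, hj, hprin⟩ := exists_isRegularCentreBlowupSeq_isLocallyPrincipal_of_noInfiniteRun hX hJ hrun
  have hres : IsResolution j := hj.isResolution hJ hX
  obtain ⟨hint, -, hJ0⟩ := hj.isIntegral_and_comap_ne_bot inferInstance inferInstance hJ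
  haveI := hint
  exact ⟨Z, j, hres, hprin.isEffectiveCartier_of_ne_bot hJ0⟩

end NoInfiniteRun

end Literature.AlgebraicGeometry.Resolution

end
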